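import Summits.BirchSwinnertonDyer.BirchSwinnertonDyer.Theorems.SignedLowerHalvesSmallImageLowerHalfBothSignsRttD2SeqJ3TowerPairing
import HarnessLib

/-!
# Route `SignedLowerHalves`, crux L `SmallImageLowerHalfBothSigns` (stmt-BirchSwinnertonDyer-23599), line `rtt_w3` v26 — stub S3β (`stub_junctionPT_ns`, row J4′,
# Poitou–Tate half), brick N2c-α: `H¹(Gal(K̄/K_∞), M) = lim→_n H¹(Gal(K̄/K_n), M)` FOR THE GLOBAL CYCLOTOMIC LAYERS — cofinality, exhaustion and KERNEL CONTROL
# (two layer classes with the same restriction to `Gal(K̄/K_∞)` agree on a deeper layer)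

WIDTH seat `bsd-line-slh-p3-w3` g25 under LEAD `cruxlead-stmt-BirchSwinnertonDyer-23599` g13 (cell `bsd-ssimc`); helper `--supports stmt-BirchSwinnertonDyer-23599`
(design memo `Lines/rtt_w3-DESIGN-S3beta-w3-g25.md`, rev 3 §5 N2c). PURE THEOREMS; no definition, no named fact, no instance, no `sorry`. The GLOBAL twin of g22's local
`J3TowerPairing.exists_resOfLe_layer_eq(_resOfLe_layer)` (p783849 family): the tree's generic `SubgroupH1Colimit` lemmas (compactness of `Γ_K`, open stabilisers) run on the
antitone family `κ.layerSubgroup n ↓ κ.kerSubgroup`. HONEST FRAMING: bookkeeping for the well-definedness of the semilocal tower pairing on `Sel^{ε,S₀}_{sat}(K_∞, M) ⊆ H¹(Gal(K̄/K_∞), M)`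
(brick N2 of S3β); nothing about S3β, E2, crux L or BSD is proved; all remain OPEN and are proved for NO curve.
References: [SerreGaloisCohomology1997] I §2.2 Prop. 8; [NeukirchSchmidtWingberg2008] I §5 (1.5.1); [Rubin2000] App. B.2.
-/

set_option autoImplicit false
set_option linter.dupNamespace false -- D-0017: single-problem summit, the namespace repeats the problem name by design
noncomputable section

open scoped Classical
open NumberField IsDedekindDomain Field

namespace Summit.BirchSwinnertonDyer.BirchSwinnertonDyer.Theorems.SmallImageRttD2Seq

open Literature.NumberTheory.GaloisRepresentations Literature.NumberTheory.EllipticCurves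

section GlobalLayers

variable {K : Type} [Field K] {p : ℕ} [Fact p.Prime] (κ : ZpExtension K p)

/-- **Cofinality of the global layers**: every open `W ⊇ Gal(K̄/K_∞)` contains some `Gal(K̄/K_n)` (compactness of `Γ_K`, `⋂ₙ U_n = U_∞`). [cite: SerreGaloisCohomology1997, I §2.2 Prop. 8] -/
theorem exists_layerSubgroup_subset (W : Set (absoluteGaloisGroup K)) (hW : IsOpen W) (hUW : (κ.kerSubgroup : Set (absoluteGaloisGroup K)) ⊆ W) :
    ∃ n : ℕ, (κ.layerSubgroup n : Set (absoluteGaloisGroup K)) ⊆ W := by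
  haveI : CompactSpace (absoluteGaloisGroup K) := absoluteGaloisGroup_compactSpace _
  exact SubgroupH1Colimit.exists_coe_subset_of_antitone _ κ.isOpen_layerSubgroup κ.layerSubgroup_antitone
    (fun g hg ↦ κ.mem_kerSubgroup_of_forall_mem_layerSubgroup fun n ↦ hg n) hW hUW

variable (M : Type) [AddCommGroup M] [TopologicalSpace M] [DiscreteTopology M] [DistribMulAction (absoluteGaloisGroup K) M]

variable {κ M} in
/-- **Exhaustion (surjectivity half) for the global layers**: every class of `H¹(Gal(K̄/K_∞), M)` is `res_n` of a class of some layer `H¹(Gal(K̄/K_n), M)`, for `M` with open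
stabilisers. [cite: SerreGaloisCohomology1997, I §2.2 Prop. 8] -/
theorem exists_resOfLe_globalLayer_eq (hstabK : ∀ m : M, IsOpen (MulAction.stabilizer (absoluteGaloisGroup K) m : Set (absoluteGaloisGroup K)))
    (x : subgroupH1 κ.kerSubgroup M) :
    ∃ (n : ℕ) (c : subgroupH1 (κ.layerSubgroup n) M), resOfLe M (κ.kerSubgroup_le_layerSubgroup n) c = x := by
  haveI : CompactSpace (absoluteGaloisGroup K) := absoluteGaloisGroup_compactSpace _
  obtain ⟨n, c, hc⟩ := SubgroupH1Colimit.exists_mem_range_resOfLe hstabK κ.isClosed_kerSubgroup (fun n ↦ κ.layerSubgroup n) κ.kerSubgroup_le_layerSubgroup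
    (exists_layerSubgroup_subset κ) x
  exact ⟨n, c, hc⟩

variable {κ M} in
/-- ★ **KERNEL CONTROL (injectivity half) for the global layers**: two layer classes `c ∈ H¹(Gal(K̄/K_n), M)`, `c′ ∈ H¹(Gal(K̄/K_{n′}), M)` with the same restriction to
`Gal(K̄/K_∞)` agree after restriction to some deeper layer `K_N`. This makes the semilocal tower pairing on `Sel^{ε,S₀}_{sat}(K_∞, M) = ⋃ₙ res_n(Sel_n)` independent of the layer
representative. [cite: SerreGaloisCohomology1997, I §2.2 Prop. 8] [cite: Rubin2000, App. B.2] -/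
theorem exists_resOfLe_globalLayer_eq_resOfLe_globalLayer
    (hstabK : ∀ m : M, IsOpen (MulAction.stabilizer (absoluteGaloisGroup K) m : Set (absoluteGaloisGroup K)))
    {n n' : ℕ} (c : subgroupH1 (κ.layerSubgroup n) M) (c' : subgroupH1 (κ.layerSubgroup n') M)
    (h : resOfLe M (κ.kerSubgroup_le_layerSubgroup n) c = resOfLe M (κ.kerSubgroup_le_layerSubgroup n') c') :
    ∃ (N : ℕ) (hn : n ≤ N) (hn' : n' ≤ N), resOfLe M (κ.layerSubgroup_antitone hn) c = resOfLe M (κ.layerSubgroup_antitone hn') c' :=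
  haveI : CompactSpace (absoluteGaloisGroup K) := absoluteGaloisGroup_compactSpace _
  SubgroupH1Colimit.exists_resOfLe_eq_resOfLe hstabK (fun n ↦ κ.layerSubgroup n) κ.isOpen_layerSubgroup κ.kerSubgroup_le_layerSubgroup κ.layerSubgroup_antitone
    (exists_layerSubgroup_subset κ) c c' h

variable {κ M} in
/-- **Kernel control at `U_∞` ⇒ at a layer**: a layer class dying in `H¹(Gal(K̄/K_∞), M)` dies on some deeper layer. [cite: SerreGaloisCohomology1997, I §2.2 Prop. 8] -/
theorem exists_resOfLe_globalLayer_eq_zero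
    (hstabK : ∀ m : M, IsOpen (MulAction.stabilizer (absoluteGaloisGroup K) m : Set (absoluteGaloisGroup K)))
    {n : ℕ} (c : subgroupH1 (κ.layerSubgroup n) M) (h : resOfLe M (κ.kerSubgroup_le_layerSubgroup n) c = 0) :
    ∃ (N : ℕ) (hn : n ≤ N), resOfLe M (κ.layerSubgroup_antitone hn) c = 0 := by
  obtain ⟨N, hn, hn', hN⟩ := exists_resOfLe_globalLayer_eq_resOfLe_globalLayer hstabK c (0 : subgroupH1 (κ.layerSubgroup n) M) (by rw [h, map_zero])
  exact ⟨N, hn, by rw [hN, map_zero]⟩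

end GlobalLayers

end Summit.BirchSwinnertonDyer.BirchSwinnertonDyer.Theorems.SmallImageRttD2Seq

end
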